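import Mathlib.NumberTheory.LegendreSymbol.JacobiSymbol
import Mathlib.NumberTheory.NumberField.ClassNumber
import Mathlib.NumberTheory.NumberField.Discriminant.Defs
import Mathlib.Analysis.SpecialFunctions.Pow.Real
import Mathlib.Analysis.SpecialFunctions.Gaussian.GaussianIntegral
import Mathlib.MeasureTheory.Integral.IntegralEqImproper
import Mathlib.Analysis.SumIntegralComparisons
import HarnessLib

/-!
# Certified quadratic class numbers: Booker's explicit Burgess bound for prime discriminants
# and the unconditional class number `h(10³¹ + 33) = 43`

Topic `Literature/NumberTheory/LFunctions`; namespace `Literature.NumberTheory.LFunctions`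
(grouping namespace `Booker2006ClassNumbers` for the table of constants `alphaTable`/`betaTable`,
`alpha`/`beta`). Typed for the
parity-realchar cell (real characters `χ_d`, `L(1, χ_d)`, class numbers; "instrument provenance":
the certified-computation literature), statement-first (D-0064): the two mathematical results of
the source AS PRINTED, as named facts (D-0014), no discharge attempted; the elementary analysis of
§2.1 (Cohen's smoothing function, Lemma (9), truncation bound (11)) PROVED.

Source: A. R. Booker, *Quadratic class numbers and character sums*, Math. Comp. **75** (2006),
no. 255, 1481–1492 [Booker2006ClassNumbers] (held: `paper:doi-10-1090-s0025-5718-06-01850-3`).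
The paper gives an algorithm computing the class number `h(d)` of the quadratic field of
discriminant `d` which "terminates unconditionally with the correct answer and, under the GRH,
executes in `O_ε(|d|^{1/4+ε})` steps" (Prop. 1, p. 1483 — an algorithmic statement, not typed), by
combining Buchmann's algorithm (which certifies a divisor `h₀ ∣ h(d)`) with a short character-sum
evaluation of `L(1, χ_d)` controlled by Burgess' theorem with explicit constants. Its two
mathematical statements are typed here:

* `booker2006_proposition2` — **§3, Proposition 2** (p. 1485), an explicit Burgess bound: for a prime
  `d ≡ 1 (mod 4)`, `d > 10²⁰`, `r ∈ {2, …, 15}` and integers `0 < M, N ≤ 2√d`,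
  `|Σ_{M ≤ n < M+N} χ_d(n)| ≤ α(r) d^{(r+1)/(4r²)} (log d + β(r))^{1/(2r)} N^{1 − 1/r}` with
  `α(r), β(r)` from Table 1 (`Booker2006ClassNumbers.alpha`, `.beta`). Here `χ_d` is the
  real primitive character of conductor `d` (the Kronecker symbol `(d/·)`); for a prime
  `d ≡ 1 (mod 4)` it is `n ↦ (n/d)` (quadratic reciprocity incl. the supplement at `2`), which is
  how it is written below (`jacobiSym n d`, Mathlib).
* `booker2006_classNumber_example` — **§4** (pp. 1489–1491): for the prime `d = 10³¹ + 33` the class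
  number of `ℚ(√d)` is `43`, unconditionally ("Computing (53) for our example, we get less than
  `1.000001 h₀R(d)`, and hence conclude that indeed `h(d) = 43`. This required approximately 95 hours
  of computation", p. 1491; `h₀ = 43` from PARI certified as a divisor of `h(d)`, regulator
  `R(d) ≈ 84328477135202.25641` checked by reduction theory, p. 1489). Typed over Mathlib's
  `NumberField.classNumber` for any number field of degree `2` and discriminant `10³¹ + 33`
  (`d` is prime and `≡ 1 (mod 4)`, hence a fundamental discriminant, so this is exactly `ℚ(√d)`).

PROVED here (§2.1, pp. 1483–1484; section `CohenSmoothing` below, namespace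
`Booker2006ClassNumbers`, no hypotheses beyond the printed ones): Cohen's smoothing function of the
approximate functional equation, eq. (8), `F(x) = ∫_x^∞ (1/x + 1/t) e^{−πt²} dt` (`cohenF`, with
`cohenF_nonneg` and the "monotonicity" remark `cohenF_antitoneOn`); the integration-by-parts
**Lemma (9)** `∫_x^∞ t^{−α} e^{−πt²} dt < e^{−πx²}/(2π x^{α+1})` for `α > −1`, `x > 0`
(`integral_Ioi_rpow_mul_exp_lt`, via the closed form `∫_x^∞ t e^{−πt²} dt = e^{−πx²}/(2π)`,
`integral_Ioi_mul_exp_neg_pi_mul_sq`); its consequence "`F(x) < (1/(πx²)) e^{−πx²}`" (p. 1484,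
`cohenF_lt`); and the truncation bound **(11)**
`√d ∫_{X/√d}^∞ F(x) dx ≤ (√d/π) ∫_{X/√d}^∞ x^{−2} e^{−πx²} dx < d² e^{−πX²/d}/(2π² X³)`
(`integral_Ioi_cohenF_lt`, `sqrt_mul_integral_cohenF_lt`) — the error term of computing `L(1, χ_d)`
from the first `X` terms of (7); together with the sum-vs-integral step **(10)**
`|Σ_{n>X} χ_d(n) F(n/√d)| ≤ Σ_{n>X} F(n/√d) ≤ √d ∫_{X/√d}^∞ F(x) dx` (`integrableOn_cohenF`,
`summable_cohenF_tail`, `tsum_cohenF_tail_le`, `abs_tsum_mul_cohenF_tail_le` for any coefficients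
of modulus `≤ 1`, e.g. `χ_d(n)`), whence the complete tail bound `Σ_{n>X} F(n/√d) <
d² e^{−πX²/d}/(2π² X³)` (`tsum_cohenF_tail_lt`), and the printed choice of `X` (p. 1484):
`X ≥ √((d/2π) log(d/2π))`, `d > 2π` ⇒ that bound is `≤ 2 (log(d/2π))^{−3/2}`
(`truncationBound_le_of_sqrt_le`, `tsum_cohenF_tail_lt_of_sqrt_le`).

Not typed: Prop. 1 (complexity statement); the approximate functional equation (7) itself,
`L(1, χ_d) = (2/√d) Σ_{n ≥ 1} χ_d(n) F(n/√d)` (Cohen's form [13, §5.6.2]; a derivation from the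
functional equation, size L); eq. (13) (GRH-conditional lower bound for `h₀R(d)`); the
prime-counting inputs (49) (Rosser–Schoenfeld type, not the paper's).

`lean search` (2026-08-26): no explicit-constant Burgess bound in the tree (`BurgessShape` of
`Zhang2022/Section3Lemma32Subconvex.lean` is a shape predicate with free constants); no decl mentions
this paper.

## References

* [Booker2006ClassNumbers] A. R. Booker, *Quadratic class numbers and character sums*, Math. Comp.
  75 (2006), 1481–1492, doi:10.1090/S0025-5718-06-01850-3 — Prop. 2 and Table 1 (p. 1485), §4
  (pp. 1489–1491).
* [Burgess1963] D. A. Burgess, *On character sums and `L`-series. II*, Proc. LMS (3) 13 (1963)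
  524–536 (the inexplicit theorem made explicit in Prop. 2).
* [IwaniecKowalski2004] H. Iwaniec, E. Kowalski, *Analytic Number Theory*, AMS Coll. Publ. 53,
  §12.4 (the method of proof of Prop. 2, per p. 1483).
-/

noncomputable section

open Finset

namespace Literature.NumberTheory.LFunctions

namespace Booker2006ClassNumbers

/-- Booker's Table 1, column `α(r)`, listed for `r = 2, …, 15`.
[cite: Booker2006ClassNumbers, §3 Table 1 (p. 1485)] -/
def alphaTable : List ℝ :=
  [1.8221, 1.8000, 1.7263, 1.6526, 1.5892, 1.5363, 1.4921, 1.4548, 1.4231, 1.3958, 1.3721, 1.3512,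
    1.3328, 1.3164]

/-- Booker's Table 1, column `β(r)`, listed for `r = 2, …, 15` (negative from `r = 10` on).
[cite: Booker2006ClassNumbers, §3 Table 1 (p. 1485)] -/
def betaTable : List ℝ :=
  [8.9077, 5.3948, 3.6658, 2.5405, 1.7059, 1.0405, 0.4856, 0.0085, -0.4106, -0.7848, -1.1232,
    -1.4323, -1.7169, -1.9808]

/-- `α(r)` of Table 1 (`r = 2, …, 15`; `0` elsewhere, where the proposition does not apply).
[cite: Booker2006ClassNumbers, §3 Table 1 (p. 1485)] -/
def alpha (r : ℕ) : ℝ :=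
  alphaTable.getD (r - 2) 0

/-- `β(r)` of Table 1 (`r = 2, …, 15`; `0` elsewhere, where the proposition does not apply).
[cite: Booker2006ClassNumbers, §3 Table 1 (p. 1485)] -/
def beta (r : ℕ) : ℝ :=
  betaTable.getD (r - 2) 0

/-- Unfolding lemma for the first row of Table 1. [cite: Booker2006ClassNumbers, §3 Table 1 (p. 1485)] -/
theorem alpha_two : alpha 2 = 1.8221 := rfl

/-- Unfolding lemma for the last row of Table 1. [cite: Booker2006ClassNumbers, §3 Table 1 (p. 1485)] -/
theorem alpha_fifteen : alpha 15 = 1.3164 := rfl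

/-- Unfolding lemma for the first row of Table 1. [cite: Booker2006ClassNumbers, §3 Table 1 (p. 1485)] -/
theorem beta_two : beta 2 = 8.9077 := rfl

/-- Unfolding lemma for the last row of Table 1. [cite: Booker2006ClassNumbers, §3 Table 1 (p. 1485)] -/
theorem beta_fifteen : beta 15 = -1.9808 := rfl

end Booker2006ClassNumbers

/-- **Booker 2006 (Math. Comp. 75), §3 Proposition 2 (explicit Burgess bound for prime
discriminants), as printed (p. 1485):** "Let `d > 10²⁰` be a prime number `≡ 1 (mod 4)`,
`r ∈ {2, …, 15}`, and `M, N` integers with `0 < M, N ≤ 2√d`. Then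
`|Σ_{M ≤ n < M+N} χ_d(n)| ≤ α(r) d^{(r+1)/(4r²)} (log d + β(r))^{1/(2r)} N^{1−1/r}`, where
`α(r), β(r)` are given by Table 1." Here `χ_d` is the quadratic character of conductor `d` (the
Kronecker symbol `(d/·)`, §1), which for a prime `d ≡ 1 (mod 4)` equals `n ↦ (n/d)` by quadratic
reciprocity (with its supplement at `2`), written `jacobiSym n d`; `log` is the natural logarithm
(`log d > 46 > −β(r)`, so the base of the `1/(2r)`-th power is positive). Proof in the source:
induction on `N` with shifted sums `n ↦ n + ab` à la Iwaniec–Kowalski §12.4 and Weil's bound (§3,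
pp. 1485–1489). Not discharged here (size L). "The restriction on `N` was chosen to suit our
application; a similar bound could be obtained for all `N` at the expense of slightly worse
constants" (Remark, p. 1485). [cite: Booker2006ClassNumbers, §3 Proposition 2 and Table 1 (p. 1485)] -/
def booker2006_proposition2 : Prop :=
  ∀ (d : ℕ), d.Prime → d % 4 = 1 → (10 : ℝ) ^ 20 < d →
    ∀ r ∈ Finset.Icc 2 15, ∀ (M N : ℕ), 0 < M → 0 < N →
      (M : ℝ) ≤ 2 * Real.sqrt d → (N : ℝ) ≤ 2 * Real.sqrt d →
        abs (∑ n ∈ Finset.Ico M (M + N), (jacobiSym (n : ℤ) d : ℝ)) ≤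
          Booker2006ClassNumbers.alpha r * (d : ℝ) ^ (((r : ℝ) + 1) / (4 * (r : ℝ) ^ 2)) *
            (Real.log d + Booker2006ClassNumbers.beta r) ^ (1 / (2 * (r : ℝ))) *
              (N : ℝ) ^ (1 - 1 / (r : ℝ))

/-- **Booker 2006 (Math. Comp. 75), §4 (pp. 1489–1491), the certified example, as printed:** for the
prime `d = 10³¹ + 33` (`≡ 1 (mod 4)`), "we use PARI/GP to compute the class number `h₀ = 43` and
regulator `R(d) ≈ 84328477135202.25641` … it is easy to verify that the supplied generator has
order `43`, so `h₀` at least divides the true class number … Computing (53) for our example, we get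
less than `1.000001 h₀R(d)`, and hence conclude that indeed `h(d) = 43`." An unconditional (GRH-free)
certified computation (≈ 95 h, interval bounds of §§2–3). Typed over Mathlib: every number field of
degree `2` and discriminant `10³¹ + 33` (i.e. `ℚ(√d)`, `d` being a prime `≡ 1 (mod 4)` and so a
fundamental discriminant) has class number `43`. Not discharged here (size XL: no kernel-checkable
certificate). [cite: Booker2006ClassNumbers, §4 (pp. 1489–1491)] -/
def booker2006_classNumber_example : Prop :=
  ∀ (K : Type) [Field K] [NumberField K],
    Module.finrank ℚ K = 2 → NumberField.discr K = 10 ^ 31 + 33 → NumberField.classNumber K = 43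

/-! ## §2.1 — Cohen's smoothing function, Lemma (9) and the truncation bound (11) (PROVED)

Booker, p. 1483: "A fast method for evaluating the `L`-function at `1` (or any point, for that
matter) is the approximate functional equation. We use a version due to Cohen [13, Sec. 5.6.2]:
(7) `L(1, χ_d) = (2/√d) Σ_{n=1}^∞ χ_d(n) F(n/√d)`, where (8) `F(x) = ∫_x^∞ (1/x + 1/t) e^{−πt²} dt`.
(N.B.: The choice of smoothing function `F` is not canonical. This particular `F` has the nice
features of monotonicity and convexity.) **Lemma.** Suppose `α > −1` and `x > 0`. Then
(9) `∫_x^∞ t^{−α} e^{−πt²} dt < e^{−πx²}/(2π x^{α+1})`. *Proof.* Integration by parts."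
P. 1484: "suppose that we compute the sum up to the first `X` terms. For the remaining terms we have
(10) `|Σ_{n=X+1}^∞ χ_d(n) F(n/√d)| ≤ Σ_{n=X+1}^∞ F(n/√d) ≤ √d ∫_{X/√d}^∞ F(x) dx`. The lemma shows
that `F(x) < (1/(πx²)) e^{−πx²}`. Hence, applying the lemma once more, we have
(11) `√d ∫_{X/√d}^∞ F(x) dx ≤ (√d/π) ∫_{X/√d}^∞ x^{−2} e^{−πx²} dx < d² e^{−πX²/d}/(2π² X³)`."

Below: (8) as a definition (`cohenF`; integrals over `Set.Ioi x` w.r.t. Lebesgue measure), (9), the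
bound on `F` and (11) as theorems. The proof of (9) given here is the one-line variant of the
printed integration by parts: for `t > x > 0`, `t^{−α} = t^{−(α+1)}·t < x^{−(α+1)}·t` (as
`α + 1 > 0`), and `∫_x^∞ t e^{−πt²} dt = e^{−πx²}/(2π)` exactly; strictness because the integrand
gap is positive on a set of positive (infinite) measure. (10) is Mathlib's integral test for
antitone functions (`AntitoneOn.tsum_comp_add_le_integral`) after the scaling `u = √d·x`
(`integral_comp_mul_right_Ioi`), using `cohenF_antitoneOn` and `integrableOn_cohenF`. (7) is not
typed. -/
section CohenSmoothing

open Real Set MeasureTheory Filter Topology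

namespace Booker2006ClassNumbers

/-- The closed form behind Lemma (9): `∫_x^∞ t e^{−πt²} dt = e^{−πx²}/(2π)` (any real `x`), by the
fundamental theorem of calculus on `(x, ∞)` for the primitive `−e^{−πt²}/(2π)`.
[cite: Booker2006ClassNumbers, §2.1 Lemma (9) proof ("Integration by parts"), p. 1483] -/
theorem integral_Ioi_mul_exp_neg_pi_mul_sq (x : ℝ) :
    ∫ t in Ioi x, t * Real.exp (-π * t ^ 2) = Real.exp (-π * x ^ 2) / (2 * π) := by
  have hderiv : ∀ t ∈ Ici x, HasDerivAt (fun u : ℝ => -Real.exp (-π * u ^ 2) / (2 * π))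
      (t * Real.exp (-π * t ^ 2)) t := by
    intro t _
    have h1 : HasDerivAt (fun u : ℝ => -π * u ^ 2) (-π * (2 * t)) t := by
      simpa using ((hasDerivAt_pow 2 t).const_mul (-π))
    refine ((h1.exp).neg.div_const (2 * π)).congr_deriv ?_
    field_simp
  have hlim : Tendsto (fun u : ℝ => -Real.exp (-π * u ^ 2) / (2 * π)) atTop
      (𝓝 (-0 / (2 * π))) := by
    have h1 : Tendsto (fun u : ℝ => π * u ^ 2) atTop atTop :=
      (tendsto_pow_atTop two_ne_zero).const_mul_atTop pi_pos
    have h2 : Tendsto (fun u : ℝ => Real.exp (-π * u ^ 2)) atTop (𝓝 0) := by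
      have := Real.tendsto_exp_atBot.comp (tendsto_neg_atTop_atBot.comp h1)
      refine this.congr' (Eventually.of_forall fun u => ?_)
      simp [neg_mul]
    exact h2.neg.div_const _
  rw [integral_Ioi_of_hasDerivAt_of_tendsto' hderiv
    (integrable_mul_exp_neg_mul_sq pi_pos).integrableOn hlim]
  ring

/-- Integrability on `(x, ∞)`, `x > 0`, of `t ↦ t^β e^{−πt²}` for every real `β ≤ 1` (domination by
`x^{β−1} · t e^{−πt²}`); used with `β = −α`, `α > −1`, in Lemma (9).
[cite: Booker2006ClassNumbers, §2.1 Lemma (9), p. 1483] -/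
theorem integrableOn_rpow_mul_exp_neg_pi_mul_sq {x β : ℝ} (hx : 0 < x) (hβ : β ≤ 1) :
    IntegrableOn (fun t : ℝ => t ^ β * Real.exp (-π * t ^ 2)) (Ioi x) := by
  have hg : IntegrableOn (fun t : ℝ => x ^ (β - 1) * (t * Real.exp (-π * t ^ 2))) (Ioi x) :=
    ((integrable_mul_exp_neg_mul_sq pi_pos).const_mul _).integrableOn
  refine hg.mono' ?_ ?_
  · refine (ContinuousOn.mul ?_ ?_).aestronglyMeasurable measurableSet_Ioi
    · exact continuousOn_id.rpow_const fun t ht => Or.inl (hx.trans ht).ne'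
    · exact Continuous.continuousOn (by fun_prop)
  · refine (ae_restrict_iff' measurableSet_Ioi).2 (Eventually.of_forall fun t ht => ?_)
    have hxt : x < t := ht
    have ht0 : 0 < t := hx.trans hxt
    rw [Real.norm_of_nonneg (by positivity)]
    have h1 : t ^ β = t ^ (β - 1) * t := by
      rw [Real.rpow_sub_one ht0.ne', div_mul_cancel₀ _ ht0.ne']
    rw [h1, mul_assoc]
    exact mul_le_mul_of_nonneg_right (Real.rpow_le_rpow_of_nonpos hx hxt.le (by linarith))
      (by positivity)

/-- **Booker 2006 (Math. Comp. 75), §2.1 Lemma, eq. (9) (p. 1483), as printed, PROVED:** "Suppose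
`α > −1` and `x > 0`. Then `∫_x^∞ t^{−α} e^{−πt²} dt < e^{−πx²}/(2π x^{α+1})`." (`t^{−α}`,
`x^{α+1}` are real powers `Real.rpow`; the integral is over `Set.Ioi x`.)
[cite: Booker2006ClassNumbers, §2.1 Lemma (9), p. 1483] -/
theorem integral_Ioi_rpow_mul_exp_lt {α x : ℝ} (hα : -1 < α) (hx : 0 < x) :
    ∫ t in Ioi x, t ^ (-α) * Real.exp (-π * t ^ 2) <
      Real.exp (-π * x ^ 2) / (2 * π * x ^ (α + 1)) := by
  set f : ℝ → ℝ := fun t => t ^ (-α) * Real.exp (-π * t ^ 2) with hf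
  set g : ℝ → ℝ := fun t => x ^ (-(α + 1)) * (t * Real.exp (-π * t ^ 2)) with hg
  have hfi : IntegrableOn f (Ioi x) := integrableOn_rpow_mul_exp_neg_pi_mul_sq hx (by linarith)
  have hgi : IntegrableOn g (Ioi x) :=
    ((integrable_mul_exp_neg_mul_sq pi_pos).const_mul _).integrableOn
  have hlt : ∀ t ∈ Ioi x, f t < g t := by
    intro t ht
    have hxt : x < t := ht
    have ht0 : 0 < t := hx.trans hxt
    simp only [hf, hg]
    have h1 : t ^ (-α) = t ^ (-(α + 1)) * t := by
      rw [show -(α + 1) = -α - 1 by ring, Real.rpow_sub_one ht0.ne', div_mul_cancel₀ _ ht0.ne']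
    rw [h1, mul_assoc]
    exact mul_lt_mul_of_pos_right (Real.rpow_lt_rpow_of_neg hx hxt (by linarith)) (by positivity)
  have hpos : 0 < ∫ t in Ioi x, (g t - f t) := by
    rw [integral_pos_iff_support_of_nonneg_ae]
    · rw [Measure.restrict_apply_superset]
      · simp [Real.volume_Ioi]
      · intro t ht
        exact Function.mem_support.2 (sub_pos.2 (hlt t ht)).ne'
    · filter_upwards [ae_restrict_mem measurableSet_Ioi] with t ht
      exact sub_nonneg.2 (hlt t ht).le
    · exact hgi.sub hfi
  rw [integral_sub hgi hfi] at hpos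
  have hgval : ∫ t in Ioi x, g t = Real.exp (-π * x ^ 2) / (2 * π * x ^ (α + 1)) := by
    simp only [hg]
    rw [integral_const_mul, integral_Ioi_mul_exp_neg_pi_mul_sq, Real.rpow_neg hx.le]
    have : 0 < x ^ (α + 1) := Real.rpow_pos_of_pos hx _
    field_simp
  linarith [hgval]

/-- Cohen's smoothing function of the approximate functional equation (7) for `L(1, χ_d)`,
eq. (8): `F(x) = ∫_x^∞ (1/x + 1/t) e^{−πt²} dt` (Lebesgue integral over `Set.Ioi x`; the paper
uses it for `x > 0`). [cite: Booker2006ClassNumbers, §2.1 eq. (8), p. 1483] -/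
def cohenF (x : ℝ) : ℝ := ∫ t in Ioi x, (1 / x + 1 / t) * Real.exp (-π * t ^ 2)

/-- Integrability of the integrand of (8) (with any constant `c` in place of `1/x`) on `(z, ∞)`,
`z > 0`. [cite: Booker2006ClassNumbers, §2.1 eq. (8), p. 1483] -/
theorem integrableOn_cohenF_integrand (c : ℝ) {z : ℝ} (hz : 0 < z) :
    IntegrableOn (fun t : ℝ => (c + 1 / t) * Real.exp (-π * t ^ 2)) (Ioi z) := by
  have h0 : IntegrableOn (fun t : ℝ => c * Real.exp (-π * t ^ 2)) (Ioi z) :=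
    ((integrable_exp_neg_mul_sq pi_pos).const_mul c).integrableOn
  have h1 : IntegrableOn (fun t : ℝ => t ^ (-(1:ℝ)) * Real.exp (-π * t ^ 2)) (Ioi z) :=
    integrableOn_rpow_mul_exp_neg_pi_mul_sq hz (by norm_num)
  refine (h0.add h1).congr_fun (fun t _ => ?_) measurableSet_Ioi
  simp only [Pi.add_apply, Real.rpow_neg_one]
  ring

/-- `F(x) ≥ 0` for `x > 0` (nonnegative integrand).
[cite: Booker2006ClassNumbers, §2.1 eq. (8), p. 1483] -/
theorem cohenF_nonneg {x : ℝ} (hx : 0 < x) : 0 ≤ cohenF x :=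
  setIntegral_nonneg measurableSet_Ioi fun t ht =>
    mul_nonneg (add_nonneg (by positivity) (one_div_nonneg.2 (hx.trans ht).le)) (Real.exp_pos _).le

/-- The "monotonicity" remark after (8) (p. 1483): `F` is non-increasing on `(0, ∞)` (for
`0 < x ≤ y` both the domain `(y, ∞) ⊆ (x, ∞)` and the integrand `1/y + 1/t ≤ 1/x + 1/t` shrink).
The "convexity" half of the remark is not typed. [cite: Booker2006ClassNumbers, §2.1 remark after
eq. (8), p. 1483] -/
theorem cohenF_antitoneOn : AntitoneOn cohenF (Ioi 0) := by
  intro x hx y hy hxy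
  have hx0 : 0 < x := hx
  have hy0 : 0 < y := hy
  calc cohenF y = ∫ t in Ioi y, (1 / y + 1 / t) * Real.exp (-π * t ^ 2) := rfl
    _ ≤ ∫ t in Ioi y, (1 / x + 1 / t) * Real.exp (-π * t ^ 2) := by
        refine setIntegral_mono_on (integrableOn_cohenF_integrand _ hy0)
          (integrableOn_cohenF_integrand _ hy0) measurableSet_Ioi fun t _ => ?_
        exact mul_le_mul_of_nonneg_right (add_le_add (one_div_le_one_div_of_le hx0 hxy) le_rfl)
          (Real.exp_pos _).le
    _ ≤ ∫ t in Ioi x, (1 / x + 1 / t) * Real.exp (-π * t ^ 2) := by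
        refine setIntegral_mono_set (integrableOn_cohenF_integrand _ hx0) ?_
          (Ioi_subset_Ioi hxy).eventuallyLE
        exact ae_restrict_of_forall_mem measurableSet_Ioi fun t ht =>
          mul_nonneg (add_nonneg (one_div_pos.2 hx0).le (one_div_pos.2 (hx0.trans ht)).le)
            (Real.exp_pos _).le
    _ = cohenF x := rfl

/-- **Booker 2006, p. 1484, as printed, PROVED:** "The lemma shows that `F(x) < (1/(πx²)) e^{−πx²}`"
(`x > 0`; Lemma (9) with `α = 0` and `α = 1`).
[cite: Booker2006ClassNumbers, §2.1, p. 1484 (line after (10))] -/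
theorem cohenF_lt {x : ℝ} (hx : 0 < x) : cohenF x < Real.exp (-π * x ^ 2) / (π * x ^ 2) := by
  have h0 := integral_Ioi_rpow_mul_exp_lt (α := 0) (by norm_num) hx
  have h1 := integral_Ioi_rpow_mul_exp_lt (α := 1) (by norm_num) hx
  simp only [neg_zero, Real.rpow_zero, one_mul, zero_add, Real.rpow_one] at h0
  have e1 : (fun t : ℝ => t ^ (-(1:ℝ)) * Real.exp (-π * t ^ 2)) =
      fun t => (1 / t) * Real.exp (-π * t ^ 2) := by
    funext t; rw [Real.rpow_neg_one, one_div]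
  have e2 : x ^ ((1:ℝ) + 1) = x ^ 2 := by
    rw [show (1:ℝ) + 1 = (2:ℕ) by norm_num, Real.rpow_natCast]
  rw [e1, e2] at h1
  have hi0 : IntegrableOn (fun t : ℝ => Real.exp (-π * t ^ 2)) (Ioi x) :=
    (integrable_exp_neg_mul_sq pi_pos).integrableOn
  have hi1 : IntegrableOn (fun t : ℝ => (1 / t) * Real.exp (-π * t ^ 2)) (Ioi x) := by
    rw [← e1]; exact integrableOn_rpow_mul_exp_neg_pi_mul_sq hx (by norm_num)
  have hsplit : cohenF x = (1 / x) * (∫ t in Ioi x, Real.exp (-π * t ^ 2)) +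
      ∫ t in Ioi x, (1 / t) * Real.exp (-π * t ^ 2) := by
    unfold cohenF
    rw [← integral_const_mul, ← integral_add (hi0.const_mul _) hi1]
    exact setIntegral_congr_fun measurableSet_Ioi fun t _ => by ring
  rw [hsplit]
  calc (1 / x) * (∫ t in Ioi x, Real.exp (-π * t ^ 2)) +
        ∫ t in Ioi x, (1 / t) * Real.exp (-π * t ^ 2)
      < (1 / x) * (Real.exp (-π * x ^ 2) / (2 * π * x)) +
        Real.exp (-π * x ^ 2) / (2 * π * x ^ 2) :=
        add_lt_add (mul_lt_mul_of_pos_left h0 (one_div_pos.2 hx)) h1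
    _ = Real.exp (-π * x ^ 2) / (π * x ^ 2) := by
        field_simp
        ring

/-- The truncation bound (11) in the variable `x₀ = X/√d` (p. 1484), PROVED:
`∫_{x₀}^∞ F(x) dx ≤ (1/π) ∫_{x₀}^∞ x^{−2} e^{−πx²} dx < e^{−πx₀²}/(2π² x₀³)` for `x₀ > 0` (the bound
on `F` and Lemma (9) with `α = 2`; no measurability of `F` is needed since only the dominating
side must be integrable). [cite: Booker2006ClassNumbers, §2.1 eq. (11), p. 1484] -/
theorem integral_Ioi_cohenF_lt {x₀ : ℝ} (hx₀ : 0 < x₀) :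
    ∫ x in Ioi x₀, cohenF x < Real.exp (-π * x₀ ^ 2) / (2 * π ^ 2 * x₀ ^ 3) := by
  have h2 := integral_Ioi_rpow_mul_exp_lt (α := 2) (by norm_num) hx₀
  have e3 : x₀ ^ ((2:ℝ) + 1) = x₀ ^ 3 := by
    rw [show (2:ℝ) + 1 = (3:ℕ) by norm_num, Real.rpow_natCast]
  rw [e3] at h2
  have hgi : IntegrableOn (fun x : ℝ => π⁻¹ * (x ^ (-(2:ℝ)) * Real.exp (-π * x ^ 2))) (Ioi x₀) :=
    (integrableOn_rpow_mul_exp_neg_pi_mul_sq hx₀ (by norm_num)).const_mul _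
  have hle : ∫ x in Ioi x₀, cohenF x ≤
      ∫ x in Ioi x₀, π⁻¹ * (x ^ (-(2:ℝ)) * Real.exp (-π * x ^ 2)) := by
    refine integral_mono_of_nonneg ?_ hgi ?_
    · filter_upwards [ae_restrict_mem measurableSet_Ioi] with x hx
      exact cohenF_nonneg (hx₀.trans hx)
    · filter_upwards [ae_restrict_mem measurableSet_Ioi] with x hx
      have hx' : 0 < x := hx₀.trans hx
      calc cohenF x ≤ Real.exp (-π * x ^ 2) / (π * x ^ 2) := (cohenF_lt hx').le
        _ = π⁻¹ * (x ^ (-(2:ℝ)) * Real.exp (-π * x ^ 2)) := by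
          rw [Real.rpow_neg hx'.le, show (2:ℝ) = (2:ℕ) by norm_num, Real.rpow_natCast]
          field_simp
  calc ∫ x in Ioi x₀, cohenF x ≤ _ := hle
    _ = π⁻¹ * ∫ x in Ioi x₀, x ^ (-(2:ℝ)) * Real.exp (-π * x ^ 2) := integral_const_mul _ _
    _ < π⁻¹ * (Real.exp (-π * x₀ ^ 2) / (2 * π * x₀ ^ 3)) :=
        mul_lt_mul_of_pos_left h2 (by positivity)
    _ = Real.exp (-π * x₀ ^ 2) / (2 * π ^ 2 * x₀ ^ 3) := by
        field_simp

/-- **Booker 2006, eq. (11) (p. 1484), as printed, PROVED:** for `d > 0` and `X > 0`,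
`√d ∫_{X/√d}^∞ F(x) dx < d² e^{−πX²/d}/(2π² X³)` — the error made in computing `L(1, χ_d)` (times
`√d/2`, cf. (3)) from the first `X` terms of (7), once the tail sum is compared with the
integral as in (10). [cite: Booker2006ClassNumbers, §2.1 eq. (11), p. 1484] -/
theorem sqrt_mul_integral_cohenF_lt {d X : ℝ} (hd : 0 < d) (hX : 0 < X) :
    Real.sqrt d * ∫ x in Ioi (X / Real.sqrt d), cohenF x <
      d ^ 2 * Real.exp (-π * X ^ 2 / d) / (2 * π ^ 2 * X ^ 3) := by
  have hs : 0 < Real.sqrt d := Real.sqrt_pos.2 hd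
  have hx₀ : 0 < X / Real.sqrt d := div_pos hX hs
  have h := integral_Ioi_cohenF_lt hx₀
  have hsq : (X / Real.sqrt d) ^ 2 = X ^ 2 / d := by rw [div_pow, Real.sq_sqrt hd.le]
  have hcube : (X / Real.sqrt d) ^ 3 = X ^ 3 / (d * Real.sqrt d) := by
    rw [div_pow, pow_succ (Real.sqrt d) 2, Real.sq_sqrt hd.le]
  rw [hsq, hcube, show -π * (X ^ 2 / d) = -π * X ^ 2 / d by ring] at h
  have hsne : Real.sqrt d ≠ 0 := hs.ne'
  have hdne : d ≠ 0 := hd.ne'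
  have hXne : X ≠ 0 := hX.ne'
  calc Real.sqrt d * ∫ x in Ioi (X / Real.sqrt d), cohenF x
      < Real.sqrt d * (Real.exp (-π * X ^ 2 / d) / (2 * π ^ 2 * (X ^ 3 / (d * Real.sqrt d)))) :=
        mul_lt_mul_of_pos_left h hs
    _ = (Real.sqrt d * Real.sqrt d) * d * Real.exp (-π * X ^ 2 / d) / (2 * π ^ 2 * X ^ 3) := by
        field_simp
    _ = d ^ 2 * Real.exp (-π * X ^ 2 / d) / (2 * π ^ 2 * X ^ 3) := by
        rw [Real.mul_self_sqrt hd.le]; ring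

/-- `F` is integrable on `(x₀, ∞)` for `x₀ > 0` (a.e.-measurable as an antitone function,
dominated by `π⁻¹ x^{−2} e^{−πx²}` via `cohenF_lt`) — so the integrals in (10)–(11) are genuine.
[cite: Booker2006ClassNumbers, §2.1 eqs. (10)–(11), p. 1484] -/
theorem integrableOn_cohenF {x₀ : ℝ} (hx₀ : 0 < x₀) : IntegrableOn cohenF (Ioi x₀) := by
  have hgi : IntegrableOn (fun x : ℝ => π⁻¹ * (x ^ (-(2:ℝ)) * Real.exp (-π * x ^ 2))) (Ioi x₀) :=
    (integrableOn_rpow_mul_exp_neg_pi_mul_sq hx₀ (by norm_num)).const_mul _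
  refine hgi.mono' ?_ ?_
  · exact (aemeasurable_restrict_of_antitoneOn measurableSet_Ioi
      (cohenF_antitoneOn.mono (Ioi_subset_Ioi hx₀.le))).aestronglyMeasurable
  · filter_upwards [ae_restrict_mem measurableSet_Ioi] with x hx
    have hx' : 0 < x := hx₀.trans hx
    rw [Real.norm_of_nonneg (cohenF_nonneg hx')]
    calc cohenF x ≤ Real.exp (-π * x ^ 2) / (π * x ^ 2) := (cohenF_lt hx').le
      _ = π⁻¹ * (x ^ (-(2:ℝ)) * Real.exp (-π * x ^ 2)) := by
        rw [Real.rpow_neg hx'.le, show (2:ℝ) = (2:ℕ) by norm_num, Real.rpow_natCast]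
        field_simp

/-- **Booker 2006, eq. (10) (p. 1484), second inequality, PROVED:** for `d > 0` and a positive
integer `X`, the tail `Σ_{n > X} F(n/√d)` (indexed as `n = m + X + 1`, `m ∈ ℕ`) is summable and
`Σ_{n>X} F(n/√d) ≤ √d ∫_{X/√d}^∞ F(x) dx` (integral test for the antitone `u ↦ F(u/√d)` on
`[X, ∞)`, then `u = √d x`). [cite: Booker2006ClassNumbers, §2.1 eq. (10), p. 1484] -/
theorem summable_cohenF_tail {d : ℝ} (hd : 0 < d) {X : ℕ} (hX : 0 < X) :
    Summable (fun m : ℕ => cohenF ((m + X + 1 : ℕ) / Real.sqrt d)) ∧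
    ∑' m : ℕ, cohenF ((m + X + 1 : ℕ) / Real.sqrt d) ≤
      Real.sqrt d * ∫ x in Ioi ((X : ℝ) / Real.sqrt d), cohenF x := by
  have hs : 0 < Real.sqrt d := Real.sqrt_pos.2 hd
  have hX' : (0 : ℝ) < X := Nat.cast_pos.2 hX
  set f : ℝ → ℝ := fun u => cohenF (u * (Real.sqrt d)⁻¹) with hf
  have anti : AntitoneOn f (Ici (X : ℝ)) := by
    intro u hu v hv huv
    have hu0 : 0 < u := hX'.trans_le hu
    have hv0 : 0 < v := hX'.trans_le hv
    exact cohenF_antitoneOn (show 0 < u * (Real.sqrt d)⁻¹ by positivity)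
      (show 0 < v * (Real.sqrt d)⁻¹ by positivity)
      (mul_le_mul_of_nonneg_right huv (inv_pos.2 hs).le)
  have integrable : IntegrableOn f (Ioi (X : ℝ)) := by
    rw [hf, integrableOn_Ioi_comp_mul_right_iff cohenF (X : ℝ) (inv_pos.2 hs)]
    exact integrableOn_cohenF (by positivity)
  have nonneg : ∀ t ∈ Ioi (X : ℝ), 0 ≤ f t := fun t ht =>
    cohenF_nonneg (by have := hX'.trans ht; positivity)
  have h1 := anti.tsum_comp_add_le_integral X integrable nonneg
  have h2 := anti.summable_of_integrableOn_Ioi integrable nonneg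
  have hint : ∫ x in Ioi (X : ℝ), f x =
      Real.sqrt d * ∫ x in Ioi ((X : ℝ) / Real.sqrt d), cohenF x := by
    simp only [hf]
    rw [integral_comp_mul_right_Ioi cohenF (X : ℝ) (inv_pos.2 hs), inv_inv, smul_eq_mul,
      div_eq_mul_inv]
  have hfe : ∀ n : ℕ, f n = cohenF (n / Real.sqrt d) := fun n => by
    simp only [hf, div_eq_mul_inv]
  refine ⟨?_, ?_⟩
  · refine (h2.comp_injective
      (fun a b h => by simpa using h : Function.Injective fun n : ℕ => n + X + 1)).congr fun n => ?_
    simp only [Function.comp, hfe]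
  · calc ∑' n : ℕ, cohenF ((n + X + 1 : ℕ) / Real.sqrt d) = ∑' n : ℕ, f (n + X + 1 : ℕ) := by
          simp only [hfe]
      _ ≤ _ := h1
      _ = _ := hint

/-- (10), second inequality alone (see `summable_cohenF_tail`).
[cite: Booker2006ClassNumbers, §2.1 eq. (10), p. 1484] -/
theorem tsum_cohenF_tail_le {d : ℝ} (hd : 0 < d) {X : ℕ} (hX : 0 < X) :
    ∑' m : ℕ, cohenF ((m + X + 1 : ℕ) / Real.sqrt d) ≤
      Real.sqrt d * ∫ x in Ioi ((X : ℝ) / Real.sqrt d), cohenF x :=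
  (summable_cohenF_tail hd hX).2

/-- **Booker 2006, eq. (10) (p. 1484), first inequality, PROVED** in the generality it uses: for any
real coefficients `c n` with `|c n| ≤ 1` (in the paper `c n = χ_d(n) ∈ {0, ±1}`),
`|Σ_{n>X} c(n) F(n/√d)| ≤ Σ_{n>X} F(n/√d)` (`d > 0`, `X` a positive integer; both tails indexed as
`n = m + X + 1`). [cite: Booker2006ClassNumbers, §2.1 eq. (10), p. 1484] -/
theorem abs_tsum_mul_cohenF_tail_le {d : ℝ} (hd : 0 < d) {X : ℕ} (hX : 0 < X) (c : ℕ → ℝ)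
    (hc : ∀ n, |c n| ≤ 1) :
    |∑' m : ℕ, c (m + X + 1) * cohenF ((m + X + 1 : ℕ) / Real.sqrt d)| ≤
      ∑' m : ℕ, cohenF ((m + X + 1 : ℕ) / Real.sqrt d) := by
  obtain ⟨hsum, -⟩ := summable_cohenF_tail hd hX
  have hs : 0 < Real.sqrt d := Real.sqrt_pos.2 hd
  have hFn : ∀ m : ℕ, 0 ≤ cohenF ((m + X + 1 : ℕ) / Real.sqrt d) := fun m =>
    cohenF_nonneg (by positivity)
  have hbound : ∀ m, ‖c (m + X + 1) * cohenF ((m + X + 1 : ℕ) / Real.sqrt d)‖ ≤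
      cohenF ((m + X + 1 : ℕ) / Real.sqrt d) := fun m => by
    rw [norm_mul, Real.norm_of_nonneg (hFn m), Real.norm_eq_abs]
    exact mul_le_of_le_one_left (hFn m) (hc _)
  have hnorm : Summable fun m : ℕ => ‖c (m + X + 1) * cohenF ((m + X + 1 : ℕ) / Real.sqrt d)‖ :=
    hsum.of_nonneg_of_le (fun m => norm_nonneg _) hbound
  calc |∑' m : ℕ, c (m + X + 1) * cohenF ((m + X + 1 : ℕ) / Real.sqrt d)|
      = ‖∑' m : ℕ, c (m + X + 1) * cohenF ((m + X + 1 : ℕ) / Real.sqrt d)‖ :=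
        (Real.norm_eq_abs _).symm
    _ ≤ ∑' m : ℕ, ‖c (m + X + 1) * cohenF ((m + X + 1 : ℕ) / Real.sqrt d)‖ :=
        norm_tsum_le_tsum_norm hnorm
    _ ≤ _ := hnorm.tsum_le_tsum hbound hsum

/-- **(10) + (11) combined (p. 1484), PROVED:** for `d > 0` and a positive integer `X`,
`Σ_{n>X} F(n/√d) < d² e^{−πX²/d}/(2π² X³)` — the truncation error of the smoothed sum (7) after `X`
terms (before dividing by `h₀R(d)` as in (3), (12)).
[cite: Booker2006ClassNumbers, §2.1 eqs. (10)–(11), p. 1484] -/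
theorem tsum_cohenF_tail_lt {d : ℝ} (hd : 0 < d) {X : ℕ} (hX : 0 < X) :
    ∑' m : ℕ, cohenF ((m + X + 1 : ℕ) / Real.sqrt d) <
      d ^ 2 * Real.exp (-π * (X : ℝ) ^ 2 / d) / (2 * π ^ 2 * (X : ℝ) ^ 3) :=
  (tsum_cohenF_tail_le hd hX).trans_lt (sqrt_mul_integral_cohenF_lt hd (Nat.cast_pos.2 hX))

/-- **Booker 2006, p. 1484 (the choice of `X`), as printed, PROVED:** "If we take
`X ≥ √((d/2π) log(d/2π))` (assuming `d` is sufficiently large for this to be defined), we see that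
the last line [the bound `d² e^{−πX²/d}/(2π² X³)` of (11)] is at most `2 (log(d/2π))^{−3/2}`."
Typed with "sufficiently large" = `d > 2π` (so that `log(d/2π) > 0` and the square root is that of
a positive number); `X` real. (Proof: with `c = d/2π`, `ℓ = log c`, `X² ≥ cℓ` gives
`e^{−πX²/d} ≤ c^{−1/2}` and `X³ ≥ (cℓ)^{3/2}`, and `d² c^{−1/2}/(2π² (cℓ)^{3/2}) = 2ℓ^{−3/2}`.) The
sequel "Dividing by `R(d)`, the result is `< 1/2` for `d ≥ 33`" involves the regulator and is not
typed. [cite: Booker2006ClassNumbers, §2.1, p. 1484 (paragraph after (11))] -/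
theorem truncationBound_le_of_sqrt_le {d X : ℝ} (hd : 2 * π < d)
    (hX : Real.sqrt (d / (2 * π) * Real.log (d / (2 * π))) ≤ X) :
    d ^ 2 * Real.exp (-π * X ^ 2 / d) / (2 * π ^ 2 * X ^ 3) ≤
      2 * Real.log (d / (2 * π)) ^ (-((3:ℝ) / 2)) := by
  set c : ℝ := d / (2 * π) with hc_def
  set ℓ : ℝ := Real.log c with hℓ_def
  have hπ2 : 0 < 2 * π := by positivity
  have hc1 : 1 < c := (one_lt_div hπ2).2 hd
  have hc0 : 0 < c := one_pos.trans hc1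
  have hℓ : 0 < ℓ := Real.log_pos hc1
  have hcl : 0 < c * ℓ := mul_pos hc0 hℓ
  have hX0 : 0 < X := (Real.sqrt_pos.2 hcl).trans_le hX
  have hX2 : c * ℓ ≤ X ^ 2 := by
    have := pow_le_pow_left₀ (Real.sqrt_nonneg _) hX 2
    rwa [Real.sq_sqrt hcl.le] at this
  have hd_eq : d = 2 * π * c := by rw [hc_def]; field_simp
  have hexp : Real.exp (-π * X ^ 2 / d) ≤ c ^ (-((1:ℝ) / 2)) := by
    rw [Real.rpow_def_of_pos hc0, Real.exp_le_exp, hd_eq]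
    have h1 : ℓ / 2 ≤ π * X ^ 2 / (2 * π * c) := by
      rw [div_le_div_iff₀ (by norm_num) (by positivity)]
      nlinarith [hX2, Real.pi_pos]
    have e : -π * X ^ 2 / (2 * π * c) = -(π * X ^ 2 / (2 * π * c)) := by ring
    rw [e]
    show -(π * X ^ 2 / (2 * π * c)) ≤ ℓ * -((1:ℝ) / 2)
    linarith
  have hX3 : (c * ℓ) ^ ((3:ℝ) / 2) ≤ X ^ 3 := by
    have h1 : (c * ℓ) ^ ((3:ℝ) / 2) ≤ (X ^ 2) ^ ((3:ℝ) / 2) :=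
      Real.rpow_le_rpow hcl.le hX2 (by norm_num)
    have h2 : (X ^ 2) ^ ((3:ℝ) / 2) = X ^ 3 := by
      rw [← Real.rpow_natCast X 2, ← Real.rpow_mul hX0.le, ← Real.rpow_natCast X 3]
      norm_num
    rwa [h2] at h1
  have hcl32 : 0 < (c * ℓ) ^ ((3:ℝ) / 2) := Real.rpow_pos_of_pos hcl _
  have hA : 0 < c ^ ((1:ℝ) / 2) := Real.rpow_pos_of_pos hc0 _
  have hB : 0 < c ^ ((3:ℝ) / 2) := Real.rpow_pos_of_pos hc0 _
  have hL : 0 < ℓ ^ ((3:ℝ) / 2) := Real.rpow_pos_of_pos hℓ _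
  have hAB : c ^ ((1:ℝ) / 2) * c ^ ((3:ℝ) / 2) = c ^ 2 := by
    rw [← Real.rpow_add hc0]; norm_num
  calc d ^ 2 * Real.exp (-π * X ^ 2 / d) / (2 * π ^ 2 * X ^ 3)
      ≤ d ^ 2 * c ^ (-((1:ℝ) / 2)) / (2 * π ^ 2 * (c * ℓ) ^ ((3:ℝ) / 2)) := by
        gcongr
    _ = (2 * π * c) ^ 2 /
          (2 * π ^ 2 * ((c ^ ((1:ℝ) / 2) * c ^ ((3:ℝ) / 2)) * ℓ ^ ((3:ℝ) / 2))) := by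
        rw [hd_eq, Real.mul_rpow hc0.le hℓ.le, Real.rpow_neg hc0.le]
        field_simp
    _ = 2 * ℓ ^ (-((3:ℝ) / 2)) := by
        rw [hAB, Real.rpow_neg hℓ.le]
        field_simp

/-- Consequence (p. 1484): for `d > 2π` and a positive integer `X ≥ √((d/2π) log(d/2π))`, the tail
of the smoothed sum satisfies `Σ_{n>X} F(n/√d) < 2 (log(d/2π))^{−3/2}` ((10), (11) and the choice
of `X`). [cite: Booker2006ClassNumbers, §2.1, p. 1484] -/
theorem tsum_cohenF_tail_lt_of_sqrt_le {d : ℝ} (hd : 2 * π < d) {X : ℕ} (hX : 0 < X)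
    (hXd : Real.sqrt (d / (2 * π) * Real.log (d / (2 * π))) ≤ X) :
    ∑' m : ℕ, cohenF ((m + X + 1 : ℕ) / Real.sqrt d) <
      2 * Real.log (d / (2 * π)) ^ (-((3:ℝ) / 2)) :=
  (tsum_cohenF_tail_lt ((show (0:ℝ) < 2 * π by positivity).trans hd) hX).trans_le
    (truncationBound_le_of_sqrt_le hd hXd)

end Booker2006ClassNumbers

end CohenSmoothing

end Literature.NumberTheory.LFunctions

end
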